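import Mathlib.Analysis.SpecialFunctions.Pow.Deriv
import Mathlib.Analysis.SpecialFunctions.Pow.Continuity
import Mathlib.Analysis.SpecialFunctions.Integrability.Basic
import Literature.NumberTheory.Transcendental.KZCubeProducts
import Literature.NumberTheory.Transcendental.KZCalculusProofs

/-!
# `CompleteModGammaSector` (stmt-KontsevichZagierPeriods-14233), line `cusp-transport-to-the-beta-world`:
# stub `stub_elliottIntegrable` — absolute integrability of `∂_tP`, `∂_uQ` on the open band (the cusp estimate)

Support file (`--supports stmt-KontsevichZagierPeriods-14233`) for the registered stub `stub_elliottIntegrable` of the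
line lead's skeleton `Cruxes/CompleteModGammaSector/Lines/cusp-transport-to-the-beta-world.lean`. Notation (functions
of `z : Fin 3 → ℝ`, `t = z 0`, `u = z 1`, `s = z 2`; rational `0 < a < 1`, `1 - a < c`; real algebraic modulus
`z₁ ∈ (0,1)`): family `F = t^{-a}(1-t)^{c+a-2}(1-st)^{-a} · u^{-a}(1-u)^{c+a-2}(1-(1-s)u)^{-a} · (1 - st - (1-s)u)`
(Elliott–Legendre combination in Euler form, AQVV 2000 Cor. 3.13 (5); `a = 1/2`, `c = 1` is Legendre's relation),
potentials `P = t^{1-a}(1-t)^{c+a-1}(1-st)^{-a} · u^{1-a}(1-u)^{c+a-2}(1-(1-s)u)^{-a}`,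
`Q = -t^{1-a}(1-t)^{c+a-2}(1-st)^{-a} · u^{1-a}(1-u)^{c+a-1}(1-(1-s)u)^{-a}`, certificate `∂_sF = ∂_tP + ∂_uQ`.

This file: `∂_tP` and `∂_uQ` are absolutely integrable on the open band `B₀ = (0,1)² × (0,z₁)`. On `B₀` one has
`1 − st ≥ 1 − z₁ > 0` and `1 − (1−s)u ≥ max(1 − u, s) > 0`, whence both derivatives are dominated by constant
multiples of the product `t^{−a}(1−t)^{c+a−2} · u^{−a}(1−u)^{c+a−2} · s^{−a}` of one-variable integrable powers
(`a < 1`, `c + a − 1 > 0`), which is integrable for the product measure (Tonelli,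
`MeasureTheory.Integrable.fintype_prod`, after `Measure.restrict_pi_pi`).

References: M. Kontsevich, D. Zagier, *Periods* (2001), §1.1–1.2; G. D. Anderson, S.-L. Qiu, M. K. Vamanamurthy,
M. Vuorinen, *Generalized elliptic integrals and modular equations*, Pacific J. Math. 192 (2000), Cor. 3.13 (5).
-/

noncomputable section

-- `Summit.KontsevichZagierPeriods.KontsevichZagierPeriods.…` is the tree's mandated layout (single-conjunct summit).
set_option linter.dupNamespace false

namespace Summit.KontsevichZagierPeriods.KontsevichZagierPeriods.CompleteModGammaSectorCuspLine

open MeasureTheory Set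
open Literature.NumberTheory.Transcendental

/-! ## The open band as a product set -/

/-- The open band `(0,1)² × (0,z₁) ⊆ ℝ³` (coordinate spelling of the engine) is the product set
`∏ᵢ Iᵢ` with `I = ((0,1), (0,1), (0,z₁))`. [folklore] -/
theorem band_eq_pi (z₁ : ℝ) :
    {z : Fin 3 → ℝ | (∀ j : Fin 2, z (Fin.castSucc j) ∈ Set.Ioo (0:ℝ) 1) ∧ z (Fin.last 2) ∈ Set.Ioo (0:ℝ) z₁} =
      Set.pi univ ![Set.Ioo (0:ℝ) 1, Set.Ioo (0:ℝ) 1, Set.Ioo (0:ℝ) z₁] := by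
  ext z
  simp only [mem_setOf_eq, mem_pi, mem_univ, forall_true_left, Fin.forall_fin_two]
  constructor
  · rintro ⟨⟨h0, h1⟩, h2⟩ i
    fin_cases i
    · simpa using h0
    · simpa using h1
    · simpa using h2
  · intro h
    exact ⟨⟨by simpa using h 0, by simpa using h 1⟩, by simpa using h 2⟩

/-- Lebesgue measure restricted to the open band is the product of the restricted one-dimensional
measures. [folklore] -/
theorem volume_restrict_band (z₁ : ℝ) :
    (volume : Measure (Fin 3 → ℝ)).restrict
        {z : Fin 3 → ℝ | (∀ j : Fin 2, z (Fin.castSucc j) ∈ Set.Ioo (0:ℝ) 1) ∧ z (Fin.last 2) ∈ Set.Ioo (0:ℝ) z₁} =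
      Measure.pi (fun i : Fin 3 =>
        (volume : Measure ℝ).restrict (![Set.Ioo (0:ℝ) 1, Set.Ioo (0:ℝ) 1, Set.Ioo (0:ℝ) z₁] i)) := by
  rw [band_eq_pi, volume_pi, Measure.restrict_pi_pi]

/-- The open band is measurable. [folklore] -/
theorem measurableSet_band (z₁ : ℝ) :
    MeasurableSet {z : Fin 3 → ℝ | (∀ j : Fin 2, z (Fin.castSucc j) ∈ Set.Ioo (0:ℝ) 1) ∧
      z (Fin.last 2) ∈ Set.Ioo (0:ℝ) z₁} := by
  rw [band_eq_pi]
  exact MeasurableSet.univ_pi fun i => by fin_cases i <;> exact measurableSet_Ioo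

/-! ## The dominating product and its integrability -/

/-- `x ↦ x^{-A}` is integrable on `(0, z₁)` for `A < 1`. [folklore] -/
theorem integrableOn_rpow_neg_Ioo {A : ℝ} (hA : A < 1) {z₁ : ℝ} (hz : 0 ≤ z₁) :
    IntegrableOn (fun x : ℝ => x ^ (-A)) (Set.Ioo 0 z₁) := by
  have h := intervalIntegral.intervalIntegrable_rpow' (a := 0) (b := z₁) (r := -A) (by linarith)
  exact ((intervalIntegrable_iff_integrableOn_Ioc_of_le hz).mp h).mono_set Ioo_subset_Ioc_self

/-- The Beta-type integrand `x ↦ x^{-A}(1-x)^{B}` is integrable on `(0,1)` for `A < 1`, `-1 < B`.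
[folklore] -/
theorem integrableOn_rpow_neg_mul_one_sub_rpow {A B : ℝ} (hA : A < 1) (hB : -1 < B) :
    IntegrableOn (fun x : ℝ => x ^ (-A) * (1 - x) ^ B) (Set.Ioo 0 1) := by
  have h := (Literature.Analysis.SpecialFunctions.Selberg.integrableOn_Ioo_rpow_mul_one_sub_rpow_and_integral_eq
    (a := 1 - A) (b := B + 1) (by linarith) (by linarith)).1
  refine h.congr_fun (fun x _ => ?_) measurableSet_Ioo
  have e1 : (1 - A) - 1 = -A := by ring
  have e2 : (B + 1) - 1 = B := by ring
  rw [e1, e2]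

/-- **The dominating product is integrable on the open band**: `t^{-A}(1-t)^{B} · u^{-A}(1-u)^{B} · s^{-A}`
is a product of one-variable integrable functions, hence integrable for the product of the restricted
measures (`MeasureTheory.Integrable.fintype_prod`). [folklore] -/
theorem integrableOn_dominator {A B : ℝ} (hA : A < 1) (hB : -1 < B) {z₁ : ℝ} (hz : 0 ≤ z₁) :
    IntegrableOn (fun z : Fin 3 → ℝ =>
        ((z 0) ^ (-A) * (1 - z 0) ^ B) * ((z 1) ^ (-A) * (1 - z 1) ^ B) * (z 2) ^ (-A))
      {z : Fin 3 → ℝ | (∀ j : Fin 2, z (Fin.castSucc j) ∈ Set.Ioo (0:ℝ) 1) ∧ z (Fin.last 2) ∈ Set.Ioo (0:ℝ) z₁} := by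
  rw [IntegrableOn, volume_restrict_band]
  let g : Fin 3 → ℝ → ℝ :=
    ![fun x => x ^ (-A) * (1 - x) ^ B, fun x => x ^ (-A) * (1 - x) ^ B, fun x => x ^ (-A)]
  have hg : ∀ i, Integrable (g i)
      ((volume : Measure ℝ).restrict (![Set.Ioo (0:ℝ) 1, Set.Ioo (0:ℝ) 1, Set.Ioo (0:ℝ) z₁] i)) := by
    intro i
    fin_cases i
    · exact integrableOn_rpow_neg_mul_one_sub_rpow hA hB
    · exact integrableOn_rpow_neg_mul_one_sub_rpow hA hB
    · exact integrableOn_rpow_neg_Ioo hA hz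
  have hprod := Integrable.fintype_prod (f := g)
    (μ := fun i : Fin 3 => (volume : Measure ℝ).restrict (![Set.Ioo (0:ℝ) 1, Set.Ioo (0:ℝ) 1, Set.Ioo (0:ℝ) z₁] i)) hg
  have hfun : (fun z : Fin 3 → ℝ =>
      ((z 0) ^ (-A) * (1 - z 0) ^ B) * ((z 1) ^ (-A) * (1 - z 1) ^ B) * (z 2) ^ (-A)) =
      fun z => ∏ i, g i (z i) := by
    funext z
    simp [Fin.prod_univ_three, g, mul_assoc]
  rw [hfun]
  exact hprod

/-! ## Pointwise domination on the band -/

/-- For a base in `(0,1]` a larger exponent gives a smaller power: `x^{1-A} ≤ x^{-A}`. [folklore] -/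
theorem rpow_one_sub_le_rpow_neg {x A : ℝ} (hx0 : 0 < x) (hx1 : x ≤ 1) : x ^ (1 - A) ≤ x ^ (-A) :=
  Real.rpow_le_rpow_of_exponent_ge hx0 hx1 (by linarith)

/-- On the band, `(1 - s t)^{e} ≤ (1 - z₁)^{e}` for `e ≤ 0`. [folklore] -/
theorem one_sub_mul_rpow_le {s t z₁ e : ℝ} (ht1 : t ≤ 1) (hs0 : 0 ≤ s) (hs1 : s ≤ z₁)
    (hz1 : z₁ < 1) (he : e ≤ 0) : (1 - s * t) ^ e ≤ (1 - z₁) ^ e :=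
  Real.rpow_le_rpow_of_nonpos (by linarith) (by nlinarith) he

/-- On the band, `(1 - (1-s) u)^{e} ≤ s^{e}` for `e ≤ 0` (`1 - (1-s)u ≥ s`). [folklore] -/
theorem one_sub_mul_rpow_le_rpow {s u e : ℝ} (hu1 : u ≤ 1) (hs0 : 0 < s) (hs1 : s ≤ 1)
    (he : e ≤ 0) : (1 - (1 - s) * u) ^ e ≤ s ^ e :=
  Real.rpow_le_rpow_of_nonpos hs0 (by nlinarith) he

/-- **Domination of `∂_tP`** on the open band by `(C+A)(1-z₁)^{-A-1}` times the dominating product.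
[folklore] -/
theorem abs_dtP_le {A C z₁ : ℝ} (hA0 : 0 < A) (hA1 : A < 1) (hCA : 1 < C + A) (hz1 : z₁ < 1)
    {t u s : ℝ} (ht : t ∈ Set.Ioo (0:ℝ) 1) (hu : u ∈ Set.Ioo (0:ℝ) 1) (hs : s ∈ Set.Ioo (0:ℝ) z₁) :
    |t ^ (-A) * (1 - t) ^ (C + A - 2) * (1 - s * t) ^ (-A - 1) *
        ((1 - A) * (1 - t) * (1 - s * t) - (C + A - 1) * t * (1 - s * t) + A * s * t * (1 - t)) *
        (u ^ (1 - A) * (1 - u) ^ (C + A - 2) * (1 - (1 - s) * u) ^ (-A))| ≤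
      (C + A) * (1 - z₁) ^ (-A - 1) *
        ((t ^ (-A) * (1 - t) ^ (C + A - 2)) * (u ^ (-A) * (1 - u) ^ (C + A - 2)) * s ^ (-A)) := by
  have hs1 : s < 1 := hs.2.trans hz1
  have h1t : 0 < 1 - t := by linarith [ht.2]
  have h1u : 0 < 1 - u := by linarith [hu.2]
  have hst : 0 < 1 - s * t := by nlinarith [ht.1, ht.2, hs.1, hs1]
  have hsu : 0 < 1 - (1 - s) * u := by nlinarith [hu.1, hu.2, hs.1, hs1]
  have p1 : 0 < t ^ (-A) := Real.rpow_pos_of_pos ht.1 _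
  have p2 : 0 < (1 - t) ^ (C + A - 2) := Real.rpow_pos_of_pos h1t _
  have p3 : 0 < (1 - s * t) ^ (-A - 1) := Real.rpow_pos_of_pos hst _
  have p4 : 0 < u ^ (1 - A) := Real.rpow_pos_of_pos hu.1 _
  have p5 : 0 < (1 - u) ^ (C + A - 2) := Real.rpow_pos_of_pos h1u _
  have p6 : 0 < (1 - (1 - s) * u) ^ (-A) := Real.rpow_pos_of_pos hsu _
  have p7 : 0 < u ^ (-A) := Real.rpow_pos_of_pos hu.1 _
  have p8 : 0 < s ^ (-A) := Real.rpow_pos_of_pos hs.1 _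
  have p9 : 0 < (1 - z₁) ^ (-A - 1) := Real.rpow_pos_of_pos (by linarith) _
  -- the bracket is bounded by `C + A`
  have hbr : |(1 - A) * (1 - t) * (1 - s * t) - (C + A - 1) * t * (1 - s * t) + A * s * t * (1 - t)| ≤ C + A := by
    have hst1 : 1 - s * t ≤ 1 := by nlinarith [hs.1, ht.1]
    have X1 : (1 - t) * (1 - s * t) ≤ 1 := mul_le_one₀ (by linarith [ht.1]) hst.le hst1
    have X2 : s * t * (1 - t) ≤ 1 :=
      mul_le_one₀ (mul_le_one₀ hs1.le ht.1.le ht.2.le) h1t.le (by linarith [ht.1])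
    have X3 : t * (1 - s * t) ≤ 1 := mul_le_one₀ ht.2.le hst.le hst1
    have h1 : 0 ≤ (1 - A) * (1 - (1 - t) * (1 - s * t)) := mul_nonneg (by linarith) (by linarith)
    have h2 : 0 ≤ A * (1 - s * t * (1 - t)) := mul_nonneg hA0.le (by linarith)
    have h3 : 0 ≤ (C + A - 1) * t * (1 - s * t) := mul_nonneg (mul_nonneg (by linarith) ht.1.le) hst.le
    have h4 : 0 ≤ (C + A - 1) * (1 - t * (1 - s * t)) := mul_nonneg (by linarith) (by linarith)
    have h5 : 0 ≤ (1 - A) * (1 - t) * (1 - s * t) := mul_nonneg (mul_nonneg (by linarith) h1t.le) hst.le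
    have h6 : 0 ≤ A * s * t * (1 - t) := mul_nonneg (mul_nonneg (mul_nonneg hA0.le hs.1.le) ht.1.le) h1t.le
    rw [abs_le]
    constructor <;> nlinarith
  -- the three monotone replacements
  have r1 : (1 - s * t) ^ (-A - 1) ≤ (1 - z₁) ^ (-A - 1) :=
    one_sub_mul_rpow_le ht.2.le hs.1.le hs.2.le hz1 (by linarith)
  have r2 : u ^ (1 - A) ≤ u ^ (-A) := rpow_one_sub_le_rpow_neg hu.1 hu.2.le
  have r3 : (1 - (1 - s) * u) ^ (-A) ≤ s ^ (-A) :=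
    one_sub_mul_rpow_le_rpow hu.2.le hs.1 hs1.le (by linarith)
  rw [abs_mul, abs_mul, abs_mul, abs_mul, abs_mul, abs_mul, abs_of_pos p1, abs_of_pos p2, abs_of_pos p3,
    abs_of_pos p4, abs_of_pos p5, abs_of_pos p6]
  calc t ^ (-A) * (1 - t) ^ (C + A - 2) * (1 - s * t) ^ (-A - 1) *
        |(1 - A) * (1 - t) * (1 - s * t) - (C + A - 1) * t * (1 - s * t) + A * s * t * (1 - t)| *
        (u ^ (1 - A) * (1 - u) ^ (C + A - 2) * (1 - (1 - s) * u) ^ (-A))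
      ≤ t ^ (-A) * (1 - t) ^ (C + A - 2) * (1 - z₁) ^ (-A - 1) * (C + A) *
        (u ^ (-A) * (1 - u) ^ (C + A - 2) * s ^ (-A)) := by
        gcongr
    _ = (C + A) * (1 - z₁) ^ (-A - 1) *
        ((t ^ (-A) * (1 - t) ^ (C + A - 2)) * (u ^ (-A) * (1 - u) ^ (C + A - 2)) * s ^ (-A)) := by ring

/-- **Domination of `∂_uQ`** on the open band by `(C+A)(1-z₁)^{-A}` times the dominating product
(the bracket is `≤ (C+A)(1 - (1-s)u)` because `1 - u ≤ 1 - (1-s)u`). [folklore] -/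
theorem abs_duQ_le {A C z₁ : ℝ} (hA0 : 0 < A) (hA1 : A < 1) (hCA : 1 < C + A) (hz1 : z₁ < 1)
    {t u s : ℝ} (ht : t ∈ Set.Ioo (0:ℝ) 1) (hu : u ∈ Set.Ioo (0:ℝ) 1) (hs : s ∈ Set.Ioo (0:ℝ) z₁) :
    |-(t ^ (1 - A) * (1 - t) ^ (C + A - 2) * (1 - s * t) ^ (-A) *
        (u ^ (-A) * (1 - u) ^ (C + A - 2) * (1 - (1 - s) * u) ^ (-A - 1) *
          ((1 - A) * (1 - u) * (1 - (1 - s) * u) - (C + A - 1) * u * (1 - (1 - s) * u) +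
            A * (1 - s) * u * (1 - u))))| ≤
      (C + A) * (1 - z₁) ^ (-A) *
        ((t ^ (-A) * (1 - t) ^ (C + A - 2)) * (u ^ (-A) * (1 - u) ^ (C + A - 2)) * s ^ (-A)) := by
  have hs1 : s < 1 := hs.2.trans hz1
  have h1t : 0 < 1 - t := by linarith [ht.2]
  have h1u : 0 < 1 - u := by linarith [hu.2]
  have hst : 0 < 1 - s * t := by nlinarith [ht.1, ht.2, hs.1, hs1]
  have hsu : 0 < 1 - (1 - s) * u := by nlinarith [hu.1, hu.2, hs.1, hs1]
  have p1 : 0 < t ^ (1 - A) := Real.rpow_pos_of_pos ht.1 _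
  have p2 : 0 < (1 - t) ^ (C + A - 2) := Real.rpow_pos_of_pos h1t _
  have p3 : 0 < (1 - s * t) ^ (-A) := Real.rpow_pos_of_pos hst _
  have p4 : 0 < u ^ (-A) := Real.rpow_pos_of_pos hu.1 _
  have p5 : 0 < (1 - u) ^ (C + A - 2) := Real.rpow_pos_of_pos h1u _
  have p6 : 0 < (1 - (1 - s) * u) ^ (-A - 1) := Real.rpow_pos_of_pos hsu _
  have p7 : 0 < t ^ (-A) := Real.rpow_pos_of_pos ht.1 _
  have p8 : 0 < s ^ (-A) := Real.rpow_pos_of_pos hs.1 _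
  have p9 : 0 < (1 - z₁) ^ (-A) := Real.rpow_pos_of_pos (by linarith) _
  -- the bracket is bounded by `(C + A) · (1 - (1-s)u)`
  have hbr : |(1 - A) * (1 - u) * (1 - (1 - s) * u) - (C + A - 1) * u * (1 - (1 - s) * u) +
      A * (1 - s) * u * (1 - u)| ≤ (C + A) * (1 - (1 - s) * u) := by
    have hB : 1 - u ≤ 1 - (1 - s) * u := by nlinarith [hu.1, hs.1]
    have g1 : 0 ≤ (1 - A) * u * (1 - (1 - s) * u) := mul_nonneg (mul_nonneg (by linarith) hu.1.le) hsu.le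
    have g2 : 0 ≤ A * (1 - u) * (1 - (1 - s) * u) := mul_nonneg (mul_nonneg hA0.le h1u.le) hsu.le
    have g3 : 0 ≤ A * ((1 - (1 - s) * u) - (1 - u)) := mul_nonneg hA0.le (by linarith)
    have g4 : 0 ≤ (C + A - 1) * u * (1 - (1 - s) * u) := mul_nonneg (mul_nonneg (by linarith) hu.1.le) hsu.le
    have g5 : 0 ≤ (C + A - 1) * (1 - (1 - s) * u) := mul_nonneg (by linarith) hsu.le
    have g6 : 0 ≤ (C + A - 1) * (1 - u) * (1 - (1 - s) * u) :=
      mul_nonneg (mul_nonneg (by linarith) h1u.le) hsu.le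
    have g7 : 0 ≤ (1 - A) * (1 - u) * (1 - (1 - s) * u) := mul_nonneg (mul_nonneg (by linarith) h1u.le) hsu.le
    have g8 : 0 ≤ A * (1 - s) * u * (1 - u) :=
      mul_nonneg (mul_nonneg (mul_nonneg hA0.le (by linarith)) hu.1.le) h1u.le
    rw [abs_le]
    constructor <;> nlinarith
  -- `B^{-A-1} · ((C+A) B) = (C+A) B^{-A}`
  have hsplit : (1 - (1 - s) * u) ^ (-A - 1) * ((C + A) * (1 - (1 - s) * u)) =
      (C + A) * (1 - (1 - s) * u) ^ (-A) := by
    have h := Real.rpow_add_one hsu.ne' (-A - 1)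
    rw [show -A - 1 + 1 = -A by ring] at h
    rw [h]
    ring
  have r1 : (1 - s * t) ^ (-A) ≤ (1 - z₁) ^ (-A) :=
    one_sub_mul_rpow_le ht.2.le hs.1.le hs.2.le hz1 (by linarith)
  have r2 : t ^ (1 - A) ≤ t ^ (-A) := rpow_one_sub_le_rpow_neg ht.1 ht.2.le
  have r3 : (1 - (1 - s) * u) ^ (-A) ≤ s ^ (-A) :=
    one_sub_mul_rpow_le_rpow hu.2.le hs.1 hs1.le (by linarith)
  have hCA0 : 0 ≤ C + A := by linarith
  rw [abs_neg, abs_mul, abs_mul, abs_mul, abs_mul, abs_mul, abs_mul, abs_of_pos p1, abs_of_pos p2,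
    abs_of_pos p3, abs_of_pos p4, abs_of_pos p5, abs_of_pos p6]
  calc t ^ (1 - A) * (1 - t) ^ (C + A - 2) * (1 - s * t) ^ (-A) *
        (u ^ (-A) * (1 - u) ^ (C + A - 2) * (1 - (1 - s) * u) ^ (-A - 1) *
          |(1 - A) * (1 - u) * (1 - (1 - s) * u) - (C + A - 1) * u * (1 - (1 - s) * u) +
            A * (1 - s) * u * (1 - u)|)
      ≤ t ^ (-A) * (1 - t) ^ (C + A - 2) * (1 - z₁) ^ (-A) *
        (u ^ (-A) * (1 - u) ^ (C + A - 2) * ((1 - (1 - s) * u) ^ (-A - 1) *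
          ((C + A) * (1 - (1 - s) * u)))) := by
        rw [← mul_assoc (u ^ (-A) * (1 - u) ^ (C + A - 2))]
        gcongr
    _ = t ^ (-A) * (1 - t) ^ (C + A - 2) * (1 - z₁) ^ (-A) *
        (u ^ (-A) * (1 - u) ^ (C + A - 2) * ((C + A) * (1 - (1 - s) * u) ^ (-A))) := by rw [hsplit]
    _ ≤ t ^ (-A) * (1 - t) ^ (C + A - 2) * (1 - z₁) ^ (-A) *
        (u ^ (-A) * (1 - u) ^ (C + A - 2) * ((C + A) * s ^ (-A))) := by
        gcongr
    _ = (C + A) * (1 - z₁) ^ (-A) *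
        ((t ^ (-A) * (1 - t) ^ (C + A - 2)) * (u ^ (-A) * (1 - u) ^ (C + A - 2)) * s ^ (-A)) := by ring

/-! ## The stub -/

/-- Stub `stub_elliottIntegrable` of line `cusp-transport-to-the-beta-world`: `∂_tP` and `∂_uQ` are
absolutely integrable on the open band `(0,1)² × (0,z₁)` (domination by the integrable product
`t^{-a}(1-t)^{c+a-2} u^{-a}(1-u)^{c+a-2} s^{-a}`, measurability of the explicit integrands).
[cite: KontsevichZagier2001, §1.2] -/
theorem stub_elliottIntegrable : ∀ (a c : ℚ) (z₁ : ℝ), 0 < a → a < 1 → 1 - a < c → 0 < z₁ → z₁ < 1 → IsAlgebraic ℚ z₁ →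
    IntegrableOn (fun z : Fin 3 → ℝ => (z 0) ^ (-(a : ℝ)) * (1 - z 0) ^ ((c : ℝ) + (a : ℝ) - 2) * (1 - z 2 * z 0) ^ (-(a : ℝ) - 1) * ((1 - (a : ℝ)) * (1 - z 0) * (1 - z 2 * z 0) - ((c : ℝ) + (a : ℝ) - 1) * z 0 * (1 - z 2 * z 0) + (a : ℝ) * z 2 * z 0 * (1 - z 0)) * ((z 1) ^ (1 - (a : ℝ)) * (1 - z 1) ^ ((c : ℝ) + (a : ℝ) - 2) * (1 - (1 - z 2) * z 1) ^ (-(a : ℝ))))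
      {z : Fin 3 → ℝ | (∀ j : Fin 2, z (Fin.castSucc j) ∈ Set.Ioo (0:ℝ) 1) ∧ z (Fin.last 2) ∈ Set.Ioo (0:ℝ) z₁} ∧
    IntegrableOn (fun z : Fin 3 → ℝ => -((z 0) ^ (1 - (a : ℝ)) * (1 - z 0) ^ ((c : ℝ) + (a : ℝ) - 2) * (1 - z 2 * z 0) ^ (-(a : ℝ)) * ((z 1) ^ (-(a : ℝ)) * (1 - z 1) ^ ((c : ℝ) + (a : ℝ) - 2) * (1 - (1 - z 2) * z 1) ^ (-(a : ℝ) - 1) * ((1 - (a : ℝ)) * (1 - z 1) * (1 - (1 - z 2) * z 1) - ((c : ℝ) + (a : ℝ) - 1) * z 1 * (1 - (1 - z 2) * z 1) + (a : ℝ) * (1 - z 2) * z 1 * (1 - z 1)))))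
      {z : Fin 3 → ℝ | (∀ j : Fin 2, z (Fin.castSucc j) ∈ Set.Ioo (0:ℝ) 1) ∧ z (Fin.last 2) ∈ Set.Ioo (0:ℝ) z₁} := by
  intro a c z₁ ha0 ha1 hac hz0 hz1 _
  have hA0 : (0:ℝ) < a := by exact_mod_cast ha0
  have hA1 : (a:ℝ) < 1 := by exact_mod_cast ha1
  have hCA : (1:ℝ) < c + a := by
    have h : ((1 - a : ℚ) : ℝ) < c := by exact_mod_cast hac
    push_cast at h
    linarith
  -- the dominating product and its integrability
  have hH := integrableOn_dominator (A := (a:ℝ)) (B := (c:ℝ) + a - 2) hA1 (by linarith) hz0.le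
  have hmeas := measurableSet_band z₁
  -- membership in the band, in numeral coordinates
  have hmem : ∀ z : Fin 3 → ℝ, z ∈ {z : Fin 3 → ℝ | (∀ j : Fin 2, z (Fin.castSucc j) ∈ Set.Ioo (0:ℝ) 1) ∧
      z (Fin.last 2) ∈ Set.Ioo (0:ℝ) z₁} → z 0 ∈ Set.Ioo (0:ℝ) 1 ∧ z 1 ∈ Set.Ioo (0:ℝ) 1 ∧ z 2 ∈ Set.Ioo (0:ℝ) z₁ := by
    rintro z ⟨h01, h2⟩
    exact ⟨by simpa using h01 0, by simpa using h01 1, by simpa using h2⟩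
  refine ⟨?_, ?_⟩
  · refine Integrable.mono' (hH.const_mul (((c:ℝ) + a) * (1 - z₁) ^ (-(a:ℝ) - 1))) ?_ ?_
    · exact Measurable.aestronglyMeasurable (by fun_prop)
    · refine (ae_restrict_iff' hmeas).2 (ae_of_all _ fun z hz => ?_)
      obtain ⟨ht, hu, hs⟩ := hmem z hz
      rw [Real.norm_eq_abs]
      exact abs_dtP_le hA0 hA1 hCA hz1 ht hu hs
  · refine Integrable.mono' (hH.const_mul (((c:ℝ) + a) * (1 - z₁) ^ (-(a:ℝ)))) ?_ ?_
    · exact Measurable.aestronglyMeasurable (by fun_prop)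
    · refine (ae_restrict_iff' hmeas).2 (ae_of_all _ fun z hz => ?_)
      obtain ⟨ht, hu, hs⟩ := hmem z hz
      rw [Real.norm_eq_abs]
      exact abs_duQ_le hA0 hA1 hCA hz1 ht hu hs

end Summit.KontsevichZagierPeriods.KontsevichZagierPeriods.CompleteModGammaSectorCuspLine
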